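import Mathlib
import Literature.NumberTheory.LFunctions.RichertBoundsFromExpSum
import Summits.ValiantsHypothesis.ValiantsHypothesis.Theorems.LiouvilleSarnakAlignedTypeICharactersMod2nBilinearSieveZeroFreeFromGrowth
import HarnessLib

/-!
# Route LiouvilleSarnak — support `AlignedTypeI` (stmt-ValiantsHypothesis-21040), line `characters_mod_2n`:
# tools for "growth of `L(s, χ mod 2^j)` from short character sums" (`…BilinearSieveGrowthFromCharSums.lean`)

Elementary lemmas for the Abel-summation step `HS → HG` of the depth-aspect Vinogradov programme
(`…BilinearSieveZeroFreeFromGrowth.lean`: `HG → HZ → AlignedTypeI`):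

* `exists_primitive_twoPower_LFunction_eq` — a non-principal `χ (mod 2^k)` has the `L`-function of a PRIMITIVE
  character mod `2^j`, `1 ≤ j ≤ k` (`L(s, χ) = L(s, χ')(1 − χ'(2)2^{-s}) = L(s, χ')`);
  (the tail `Σ_{n ≥ 0} (n + N + 1)^{−σ−1} ≤ N^{−σ}/σ` is the tree's `RichertFromExpSum.tsum_rpow_tail_le`);
* `bound_dichotomy` — the trivial/Vinogradov dichotomy for one Abel term: `S ≤ e^l`, `S ≤ C₁e^l e^{−cl³/L²}`,
  `σ ≥ 1 − w`, `wT ≤ log 2`, `wL² ≤ cT²` ⟹ `S ≤ (C₁ + 2)e^{σl}`;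
* `bound_period` — `S ≤ e^{L/2} + C₁ e^L e^{−cL/8}` uniformly for `0 ≤ l ≤ L`;
* `norm_partialSum_le_of_le` — periodicity `S(N + q) = S(N)` transports a bound on `[0, q]` to all `N`.

HONEST FRAMING. Helper lemmas only; nothing here bears on `VP ≠ VNP` (NOT proved) and the leaf is NOT closed here.
-/

set_option linter.dupNamespace false

noncomputable section

namespace Summit.ValiantsHypothesis.ValiantsHypothesis.Theorems.LiouvilleSarnak.AlignedTypeI.CharactersModTwoN

open Complex Filter Topology Finset
open Literature.NumberTheory.LFunctions

/-! ### Reduction to primitive characters -/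

/-- **A non-principal character mod `2^k` has the `L`-function of a primitive character mod `2^j`, `1 ≤ j ≤ k`** (the
primitive character `χ'` inducing it: `L(s, χ) = L(s, χ')·(1 − χ'(2)2^{-s}) = L(s, χ')` as `χ'(2) = 0`). [folklore] -/
theorem exists_primitive_twoPower_LFunction_eq (k : ℕ) (ψ : DirichletCharacter ℂ (2 ^ k)) (hψ : ψ ≠ 1) :
    ∃ j : ℕ, 1 ≤ j ∧ j ≤ k ∧ ∃ χ : DirichletCharacter ℂ (2 ^ j), χ.IsPrimitive ∧
      ∀ s : ℂ, ψ.LFunction s = χ.LFunction s := by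
  haveI : NeZero (2 ^ k) := ⟨pow_ne_zero _ two_ne_zero⟩
  obtain ⟨j, hjk, hdj⟩ := (Nat.dvd_prime_pow Nat.prime_two).mp (DirichletCharacter.conductor_dvd_level ψ)
  have hj1 : 1 ≤ j := by
    by_contra h0
    have hj0 : j = 0 := by omega
    rw [hj0, pow_zero] at hdj
    exact hψ (DirichletCharacter.eq_one_iff_conductor_eq_one.mpr hdj)
  have hk1 : 1 ≤ k := hj1.trans hjk
  refine ⟨j, hj1, hjk, ?_⟩
  haveI : NeZero (2 ^ j) := ⟨pow_ne_zero _ two_ne_zero⟩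
  haveI : NeZero ψ.conductor := ⟨DirichletCharacter.conductor_ne_zero ψ⟩
  have h₁ : ψ.conductor ∣ 2 ^ j := dvd_of_eq hdj
  have h₂ : 2 ^ j ∣ 2 ^ k := pow_dvd_pow 2 hjk
  set χ₁ : DirichletCharacter ℂ (2 ^ j) := DirichletCharacter.changeLevel h₁ ψ.primitiveCharacter with hχ₁
  have hprim : χ₁.IsPrimitive := by
    rw [DirichletCharacter.isPrimitive_def, hχ₁, DirichletCharacter.conductor_changeLevel]
    have h3 : ψ.primitiveCharacter.conductor = ψ.conductor :=
      DirichletCharacter.primitiveCharacter_isPrimitive ψ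
    rw [h3, hdj]
  have hψeq : DirichletCharacter.changeLevel h₂ χ₁ = ψ := by
    rw [hχ₁, ← DirichletCharacter.changeLevel_trans]
    exact DirichletCharacter.changeLevel_primitiveCharacter ψ
  have hne : χ₁ ≠ 1 := ne_one_of_isPrimitive_twoPower hj1 χ₁ hprim
  refine ⟨χ₁, hprim, fun s => ?_⟩
  rw [← hψeq, DirichletCharacter.LFunction_changeLevel h₂ χ₁ (Or.inl hne),
    Nat.primeFactors_prime_pow (by omega) Nat.prime_two, Finset.prod_singleton,
    char_twoPower_apply_two hj1 χ₁, zero_mul, sub_zero, mul_one]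

/-! ### Real-variable lemmas -/

/-- **The dichotomy for one Abel term.**  If `S ≤ e^l` (trivial bound, `l = log N ≥ 0`) and
`S ≤ C₁ e^l e^{−c l³/L²}` (Vinogradov–Gallagher bound, `L = log q > 0`), `σ ≥ 1 − w`, `w ≥ 0`, and `T ≥ 0` is a threshold
with `w T ≤ log 2` and `w L² ≤ c T²`, then `S ≤ (C₁ + 2) e^{σ l}`: for `l < T`, `e^{(1−σ)l} ≤ e^{wT} ≤ 2`; for `l ≥ T`,
`(1 − σ) l ≤ w l ≤ c l³/L²`. [folklore] -/
theorem bound_dichotomy {S l w c L C₁ σ T : ℝ} (hl : 0 ≤ l) (hC₁ : 0 ≤ C₁) (hc : 0 < c) (hw0 : 0 ≤ w)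
    (hL : 0 < L) (hT : 0 ≤ T) (hσ : 1 - w ≤ σ) (hwT : w * T ≤ Real.log 2) (hwL : w * L ^ 2 ≤ c * T ^ 2)
    (hS_triv : S ≤ Real.exp l) (hS_vin : S ≤ C₁ * Real.exp l * Real.exp (-c * l ^ 3 / L ^ 2)) :
    S ≤ (C₁ + 2) * Real.exp (σ * l) := by
  have hE : 0 < Real.exp (σ * l) := Real.exp_pos _
  have hsplit : Real.exp l = Real.exp (σ * l) * Real.exp ((1 - σ) * l) := by
    rw [← Real.exp_add]; ring_nf
  by_cases hcase : l < T
  · -- trivial regime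
    have h2 : Real.exp ((1 - σ) * l) ≤ 2 := by
      have h3 : (1 - σ) * l ≤ w * T := by nlinarith
      calc Real.exp ((1 - σ) * l) ≤ Real.exp (w * T) := Real.exp_le_exp.2 h3
        _ ≤ Real.exp (Real.log 2) := Real.exp_le_exp.2 hwT
        _ = 2 := Real.exp_log (by norm_num)
    calc S ≤ Real.exp l := hS_triv
      _ = Real.exp (σ * l) * Real.exp ((1 - σ) * l) := hsplit
      _ ≤ Real.exp (σ * l) * 2 := by gcongr
      _ ≤ (C₁ + 2) * Real.exp (σ * l) := by nlinarith [hE]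
  · -- Vinogradov regime
    rw [not_lt] at hcase
    have hl2 : T ^ 2 ≤ l ^ 2 := pow_le_pow_left₀ hT hcase 2
    have hwl : w * L ^ 2 ≤ c * l ^ 2 := hwL.trans (mul_le_mul_of_nonneg_left hl2 hc.le)
    -- `(1 - σ) l L² ≤ w l L² ≤ c l³`
    have hexp : (1 - σ) * l + -c * l ^ 3 / L ^ 2 ≤ 0 := by
      have hL2 : 0 < L ^ 2 := by positivity
      have h1 : (1 - σ) * l ≤ w * l := by nlinarith
      have h2 : w * l * L ^ 2 ≤ c * l ^ 3 := by nlinarith [mul_le_mul_of_nonneg_left hwl hl]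
      have h3 : w * l ≤ c * l ^ 3 / L ^ 2 := by rw [le_div_iff₀ hL2]; exact h2
      have h4 : -c * l ^ 3 / L ^ 2 = -(c * l ^ 3 / L ^ 2) := by ring
      linarith
    calc S ≤ C₁ * Real.exp l * Real.exp (-c * l ^ 3 / L ^ 2) := hS_vin
      _ = C₁ * Real.exp (σ * l) * Real.exp ((1 - σ) * l + -c * l ^ 3 / L ^ 2) := by
          rw [hsplit, Real.exp_add]; ring
      _ ≤ C₁ * Real.exp (σ * l) * 1 := by
          gcongr
          calc Real.exp ((1 - σ) * l + -c * l ^ 3 / L ^ 2) ≤ Real.exp 0 := Real.exp_le_exp.2 hexp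
            _ = 1 := Real.exp_zero
      _ ≤ (C₁ + 2) * Real.exp (σ * l) := by nlinarith [hE]

/-- **The uniform bound over a period.**  If `S ≤ e^l` and `S ≤ C₁ e^l e^{−c l³/L²}` with `0 ≤ l ≤ L`, then
`S ≤ e^{L/2} + C₁ e^L e^{−cL/8}` (`l ≤ L/2`: trivial; `l > L/2`: `l³ ≥ L³/8`). [folklore] -/
theorem bound_period {S l L c C₁ : ℝ} (hlL : l ≤ L) (hL : 0 < L) (hc : 0 ≤ c) (hC₁ : 0 ≤ C₁)
    (hS_triv : S ≤ Real.exp l) (hS_vin : S ≤ C₁ * Real.exp l * Real.exp (-c * l ^ 3 / L ^ 2)) :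
    S ≤ Real.exp (L / 2) + C₁ * Real.exp L * Real.exp (-c * L / 8) := by
  have hA : 0 ≤ Real.exp (L / 2) := (Real.exp_pos _).le
  have hB : 0 ≤ C₁ * Real.exp L * Real.exp (-c * L / 8) := by positivity
  by_cases hcase : l ≤ L / 2
  · calc S ≤ Real.exp l := hS_triv
      _ ≤ Real.exp (L / 2) := Real.exp_le_exp.2 hcase
      _ ≤ _ := le_add_of_nonneg_right hB
  · rw [not_le] at hcase
    have hL2 : 0 < L ^ 2 := by positivity
    have hl3 : L ^ 3 / 8 ≤ l ^ 3 := by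
      have : (L / 2) ^ 3 ≤ l ^ 3 := pow_le_pow_left₀ (by positivity) hcase.le 3
      nlinarith
    have hexp : -c * l ^ 3 / L ^ 2 ≤ -c * L / 8 := by
      rw [div_le_iff₀ hL2]
      have : c * (L ^ 3 / 8) ≤ c * l ^ 3 := mul_le_mul_of_nonneg_left hl3 hc
      nlinarith
    calc S ≤ C₁ * Real.exp l * Real.exp (-c * l ^ 3 / L ^ 2) := hS_vin
      _ ≤ C₁ * Real.exp L * Real.exp (-c * L / 8) := by
          gcongr
      _ ≤ _ := le_add_of_nonneg_left hA

/-- Periodicity: a bound for `‖S(N)‖`, `N ≤ q`, holds for all `N` (`S(N + q) = S(N)`, `χ ≠ χ₀`). [folklore] -/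
theorem norm_partialSum_le_of_le {q : ℕ} [NeZero q] (χ : DirichletCharacter ℂ q) (hχ : χ ≠ 1) {B : ℝ}
    (hB : ∀ N : ℕ, N ≤ q → ‖DirichletAbel.partialSum χ N‖ ≤ B) (N : ℕ) :
    ‖DirichletAbel.partialSum χ N‖ ≤ B := by
  induction N using Nat.strong_induction_on with
  | _ N ih =>
    rcases le_or_gt N q with hN | hN
    · exact hB N hN
    · obtain ⟨k, rfl⟩ := Nat.exists_eq_add_of_le hN.le
      rw [add_comm, DirichletAbel.partialSum_add_level χ hχ]
      exact ih k (by have := NeZero.pos q; omega)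

end Summit.ValiantsHypothesis.ValiantsHypothesis.Theorems.LiouvilleSarnak.AlignedTypeI.CharactersModTwoN
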